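import Summits.BirchSwinnertonDyer.BirchSwinnertonDyer.Theorems.KimAtThreeD7uRefinedData
import HarnessLib

/-!
# D7-u, file D: from refined invariance to a `B`-valued, inertia-trivial representative
# (route W2 = `KimAtThreeKolyvagin`, crux 19560 (C3) / TamDiv∞; seat `bsd-addord-w2-tamdiv`)

Generic group cohomology (no number field).  The refined THEOREM A2 (file C4,
`exists_refined_deriv_fixed`) produces refined data `(z, η)` on `U` with `[z] = D_r (red_* c)`,
(C2), the `I`-part of (L), and `g · (z, η) − (z, η)` null for all `g` in a set containing the place
datum `D`.  For the derivative class `κ = [Φ]` one has `[Φ|_U] = [z]`, i.e. `z = Φ|_U + dβ₀`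
(`hzΦ`).  This file (`exists_apply_sub_mem_and_apply_eq`) shifts `η` by the exact null datum of
`β₀` and applies file A's EXTRACTION LEMMAS (`apply_sub_mem_of_fixed`, `apply_eq_of_L`): there is
`β ∈ X` with `Φ(δ) − (δβ − β) ∈ B` for `δ ∈ D` and `Φ(τ) = τβ − β` for `τ ∈ I` — the cocycle
`Φ − dβ` is `B`-valued on the decomposition group and vanishes on inertia ([MR04] Remark A.5's
`H¹_{𝓕_u}` at a bad place, granted `B = red(T^I)`).  No definition, no named fact, no `sorry`.

References: B. Mazur, K. Rubin, Mem. AMS 799 (2004), App. A Prop. A.2, Remark A.5; K. Rubin,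
*Euler Systems* (2000), Thm. 4.5.1, §4.6.
-/

set_option autoImplicit false
-- the Theorems namespace of a single-conjunct summit repeats the summit name by design (D-0017)
set_option linter.dupNamespace false

noncomputable section

open CategoryTheory Function
open Literature.NumberTheory.GaloisRepresentations
open Literature.NumberTheory.EllipticCurves (subgroupConj subgroupConj_apply_coe)

universe u v

namespace Summit.BirchSwinnertonDyer.BirchSwinnertonDyer.Theorems.KimAtThreeD7uRefined

variable {R : Type v} [CommRing R] [TopologicalSpace R]
variable {G : Type u} [Group G] [TopologicalSpace G] [IsTopologicalGroup G]
variable (X : TopRep.{u} R G) (U : Subgroup G) [U.Normal]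
variable (B : Submodule R X) (D I : Subgroup G)

/-- Local notation: `𝔠⟦g⟧ z` = the conjugate cocycle `x ↦ g • z(g⁻¹ x g)` on `U`. -/
local notation3 (prettyPrint := false) "𝔠⟦" g "⟧" => contOneCocycles.pullback (subgroupConj U g) (conjRepHom X U g)

/-- Local notation: `Φ|ᵤ` = restriction of a `G`-cocycle to `U`. -/
local notation3 (prettyPrint := false) "𝐢⟦" Φ "⟧" => contOneCocycles.pullback (subgroupSubtypeHom U)
    (Y := subgroupRep X U) (TopRep.ofHom ⟨ContinuousLinearMap.id R X, fun _ => rfl⟩) Φ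

omit [IsTopologicalGroup G] [U.Normal] in
/-- Values of the restriction. [folklore] -/
theorem restrictU_apply (Φ : contOneCocycles X) (x : U) : (𝐢⟦Φ⟧).1 x = Φ.1 (x : G) := rfl

/-- **From refined invariance to the `𝓕_u`-representative.**  Let `Φ` be a continuous crossed
homomorphism on `G`, `(z, η)` refined data on `U` with `z = Φ|_U + dβ₀` (`hzΦ`), (C2), the `I`-part of
(L), and `δ · (z, η) − (z, η)` NULL for every `δ ∈ D` (`hfix`); assume `X^U = 0` (`h0`) and that all
conjugates of `I` lie in `U`.  Then for some `β ∈ X`: `Φ(δ) − (δβ − β) ∈ B` for all `δ ∈ D` and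
`Φ(τ) = τβ − β` for all `τ ∈ I`. [cite: MazurRubin2004, App. A Remark A.5] -/
theorem exists_apply_sub_mem_and_apply_eq
    (h0 : ∀ v : X, (∀ u ∈ U, X.ρ u v = v) → v = 0)
    (hIU : ∀ (g τ : G), τ ∈ I → g * τ * g⁻¹ ∈ U)
    (Φ : contOneCocycles X) (z : contOneCocycles (subgroupRep X U)) (η : G → X) (β₀ : X)
    (hzΦ : ∀ x : U, z.1 x = Φ.1 (x : G) + (X.ρ (x : G) β₀ - β₀))
    (hC2 : ∀ (g δ : G), δ ∈ D → η (g * δ) - X.ρ δ⁻¹ (η g) ∈ B)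
    (hLI : ∀ (g τ : G) (hτ : τ ∈ I),
      X.ρ g⁻¹ (z.1 ⟨g * τ * g⁻¹, hIU g τ hτ⟩) - (X.ρ τ (η g) - η g) = 0)
    (hfix : ∀ δ ∈ D, ∃ α : X, (∀ x : U, (𝔠⟦δ⟧ z - z).1 x = X.ρ (x : G) α - α) ∧
      ∀ h : G, (η (δ⁻¹ * h) - η h) - X.ρ h⁻¹ α ∈ B) :
    ∃ β : X, (∀ δ ∈ D, Φ.1 δ - (X.ρ δ β - β) ∈ B) ∧ (∀ τ ∈ I, Φ.1 τ = X.ρ τ β - β) := by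
  have hI1 : ∀ τ ∈ I, τ ∈ U := fun τ hτ => by simpa using hIU 1 τ hτ
  -- shift `η` by the exact null datum of `β₀`
  set η' : G → X := fun g => η g - X.ρ g⁻¹ β₀ with hη'
  refine ⟨η' 1, fun δ hδ => ?_, fun τ hτ => ?_⟩
  · refine apply_sub_mem_of_fixed X U B D Φ η' h0 (fun δ' hδ' => ?_) (fun δ' hδ' => ?_) δ hδ
    · -- (C2) at `g = 1` for `η'`
      have h := hC2 1 δ' hδ'
      rw [one_mul] at h
      have e : η' δ' - X.ρ δ'⁻¹ (η' 1) = η δ' - X.ρ δ'⁻¹ (η 1) := by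
        simp only [hη', inv_one, map_one, one_apply_eq_self, map_sub]
        abel
      rw [e]
      exact h
    · -- the null witness for `Φ|_U`: `α' = α − (δβ₀ − β₀)`
      obtain ⟨α, hα, hηα⟩ := hfix δ' hδ'
      refine ⟨α - (X.ρ δ' β₀ - β₀), fun x => ?_, fun g => ?_⟩
      · have h1 := hα x
        rw [Submodule.coe_sub, ContinuousMap.sub_apply, conj_apply, hzΦ, hzΦ] at h1
        rw [Submodule.coe_sub, ContinuousMap.sub_apply, conj_apply, restrictU_apply, restrictU_apply]
        change X.ρ δ' (Φ.1 (δ'⁻¹ * x * δ')) - Φ.1 x = _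
        change X.ρ δ' (Φ.1 (δ'⁻¹ * x * δ') + (X.ρ (δ'⁻¹ * x * δ') β₀ - β₀)) -
          (Φ.1 x + (X.ρ (x : G) β₀ - β₀)) = X.ρ (x : G) α - α at h1
        rw [map_add, map_sub, ← ρ_mul_apply, show δ' * (δ'⁻¹ * (x : G) * δ') = x * δ' by group,
          ρ_mul_apply] at h1
        rw [map_sub, map_sub]
        have e : X.ρ δ' (Φ.1 (δ'⁻¹ * x * δ')) - Φ.1 x =
            (X.ρ δ' (Φ.1 (δ'⁻¹ * x * δ')) + (X.ρ (x : G) (X.ρ δ' β₀) - X.ρ δ' β₀) -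
              (Φ.1 x + (X.ρ (x : G) β₀ - β₀))) -
            (X.ρ (x : G) (X.ρ δ' β₀) - X.ρ (x : G) β₀ - (X.ρ δ' β₀ - β₀)) := by abel
        rw [e, h1]
        abel
      · have h2 := hηα g
        have e : η' (δ'⁻¹ * g) - η' g - X.ρ g⁻¹ (α - (X.ρ δ' β₀ - β₀)) =
            η (δ'⁻¹ * g) - η g - X.ρ g⁻¹ α := by
          simp only [hη', mul_inv_rev, inv_inv, map_sub, ρ_mul_apply]
          abel
        rw [e]
        exact h2
  · refine apply_eq_of_L X U I Φ η' hI1 (fun τ' hτ' h => ?_) τ hτ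
    have h1 := hLI 1 τ' hτ'
    rw [hzΦ] at h1
    rw [restrictU_apply]
    simp only [inv_one, map_one, one_apply_eq_self, one_mul, mul_one] at h1 ⊢
    have e : Φ.1 τ' - (X.ρ τ' (η' 1) - η' 1) =
        Φ.1 τ' + (X.ρ τ' β₀ - β₀) - (X.ρ τ' (η 1) - η 1) := by
      simp only [hη', inv_one, map_one, one_apply_eq_self, map_sub]
      abel
    rw [e]
    exact h1

end Summit.BirchSwinnertonDyer.BirchSwinnertonDyer.Theorems.KimAtThreeD7uRefined

end
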